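import Summits.QuantumFields.YangMills.Theorems.BalabanUVNodesN16SchemeGaugeInvariants
import Summits.QuantumFields.BalabanUV.T4Continuum.Spine.NE2.TorusBlockAverageConstant
import Literature.MathematicalPhysics.QuantumFieldTheory.Balaban1983to89.Node00.ShearedAveragingRecordPureGauge
import HarnessLib

/-!
# YM-DAG node N16 (NE3), the located averaging pin (42) ↔ (0.4) — part 23: THE CENTRE WITNESS — the criterion road for the scheme OF RECORD `step04`,
# AS TYPED over the `U(N)` class `sfClass` (part 18 §4), is CLOSED AT ORDER ZERO by g0's divergence (d1); constant connections do NOT separate the schemes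

Cell `pub-ymgap`, width seat `pub-ymgap-dag-n16-w3` (director-ym №197 ∕ HUMAN RULING D-0149), generation 8; part 23 of the W1b lineage (g0 p584628 `…N16AveragingPin`:
`avgIterS`, `step42`, `descendSU`, `step04`; part 12 p612224 `ExactGaugeDefect`; part 14 p616704 `SchemeGaugeEquiv`; part 18 p626077 `transfers_of_schemeGaugeEquiv_step04`).
`--kind proof --supports stmt-QuantumFields-27366 --as helper` (K3⁸ `SpineGivenEndpointR13SepCoPHV`, KEY MAP v2; count-neutral; 0 `def`).  `bears_on: R4∕N16`.

THE POINT.  Part 18 §4 displayed the ROAD «if the (0.4)-scheme of record `step04 F N` is pointwise coarse-gauge equivalent to (43) on N16's classes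
`sfClass 4 F.L (2L^m) ε (k+1)`, `0 < ε ≤ ε₁`, then both of g0's pins `Transfer42to04 ∧ Transfer04to42` hold», and `W3-PIN-ANATOMY-v4∕v5` expected that hypothesis to FAIL
at non-abelian second order (numerical trace witness «disprover-wanted»).  This file certifies in the kernel, with no numerics, that it fails ALREADY AT ORDER ZERO, for
the reason g0 located as divergence (d1): `sfClass` is `U(N)`-valued, the record's torus fields are `SU(N)`-valued, and `descendSU` sends a non-`SU(N)` bond variable to `1`.
 * §1 CONSTANTS ON THE B7 FOLD: (42) maps `U ≡ c` to `U ≡ c^L` EXACTLY (pub-balaban-gaps NE2 `TorusBlockAverageConstant.bavg_const`), so `avgIter L (· ≡ c) k ≡ c^{L^k}`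
   (`avgIter_const`: (43) PRESERVES THE POLYAKOV PHASE of a constant connection); a unitary constant lies in `sfClass d L T ε k` for EVERY `ε ≥ 0` (`const_mem_sfClass`).
 * §2 THE READING OF RECORD ON CONSTANTS: for `c ∉ SU(N)` the descent is the TRIVIAL torus field (`descendSU_const_of_not_mem`), whose (0.4)-average is trivial
   (`Node00.avOfRecord_avg_one`), so `avgIterS (step04 F N) (k+1) (· ≡ c) ≡ 1` (`avgIterS_step04_succ_const_of_not_mem`): the phase is LOST at the first step.
 * §3 THE OBSTRUCTION: a `T`-periodic site gauge `κ` with `(· ≡ 1) = (· ≡ c')^{κ}` has `κ(x + n•e_μ) = κ(x)·c'^n`, hence `c'^T = 1` (`pow_eq_one_of_one_eq_gaugeAct_const`).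
   So for `c ∉ SU(N)` with `c^{L^{k+1}·T} ≠ 1`: ★★ `¬ SchemeGaugeEquiv 4 (step42 F.L) (step04 F N) F.L T (k+1) C` and ★★ `¬ ExactGaugeDefect 4 (step04 F N) F.L T (k+1) C` for EVERY
   class `C ∋ (· ≡ c)`; such `c` exist in the `U(1)` centre for every `N ≥ 1` and exponent (`exists_centre_unit`: `ω·1`, `ω = e^{2πi∕M}`, `M = N·m + 1`,
   `Complex.isPrimitiveRoot_exp`) ⇒ ★★ `not_schemeGaugeEquiv_step04_sfClass` ∕ `not_exactGaugeDefect_step04_sfClass` for EVERY `ε ≥ 0`, `T ≥ 1`, depth `k+1`, and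
   ★★ `not_hypothesis_transfers_of_schemeGaugeEquiv_step04`: the hypothesis `hE` of part 18's `transfers_of_schemeGaugeEquiv_step04` is UNSATISFIABLE for every `ε₁ > 0`.
 * §4 POSITIVE COMPLEMENT (the witness set among constants is exactly the `U(N) ∖ SU(N)` centre): for a constant `SU(N)`-valued `c` (central or not — all transports are
   powers of `c`) the reading is LITERAL, every (0.4) loop variable is `c^0 = 1` (`loopHol_const`), the straight transporter is `c^L` (`axialAvg_const`), so
   `step04 F N t (· ≡ c) ≡ c^L` and ★★ `avgIterS (step04 F N) k (· ≡ c) = avgIter F.L (· ≡ c) k` (`avgIterS_step04_const_eq_avgIter`): constants do NOT separate (0.4) from (43).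
LOCATED REPAIR (for the planners, D-0014; nothing re-cut, no item filed): any (0.4)-side transfer road must be typed over `SU(N)`-VALUED small classes
`sfClass ∩ {U | ∀ x μ, U x μ ∈ SU(N)}` (the currency of N16's data of record, `Node00.ne3DomOfRecord₁₁_eq_setOf`), where the open content is `W3-PIN-ANATOMY-v4` §4 (i) (the
gauge-INVARIANT non-abelian second∕third order per step) UNCHANGED; v5 §3's «any future proof that the (0.4)-side scheme is pointwise coarse-gauge equivalent to (43) on the
small classes … would make N16's leaf, bodies AND end numbers transfer» is CORRECTED: over `sfClass` as typed no such proof exists.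
HONEST FRAMING.  [folklore] bookkeeping BY NAME (NE2 `bavg_const`, `Node00.avOfRecord_avg_one`, `T3DescentFibreTower.expMeanLogSU_E_one`) + roots of unity; 0 `def`, 0 `sorry`;
`SchemeGaugeEquiv`∕`ExactGaugeDefect` are this seat's own criteria, NOT ledger items — NOT-A-REFUTATION of anything of record; no minimiser constructed; nothing of
[Balaban1985Averaging] ∕ [Balaban1987RG1] asserted; K3⁸∕K3⁷ stubs NOT touched; N16 ∕ NE3 NOT discharged; count-neutral (typed 28∕28 · discharged 5∕28 — unmoved).  One finite
four-torus programme at fixed `ε` — the Yang–Mills mass gap (Clay) is NOT proved by any of this; R4 closes the conditional finite-𝕋⁴ rung `BalabanLadder.UV` only; nothing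
continuum ∕ ℝ⁴ ∕ OS.
-/

set_option autoImplicit false

open scoped BigOperators Matrix Matrix.Norms.L2Operator
open NormedSpace

namespace Summit.QuantumFields.YangMills.BalabanUVNodes.N16Step04CentreWitness

open Literature.MathematicalPhysics.QuantumFieldTheory.Balaban1983to89
open B7Prop1Explicit (hol gaugeAct plaqWord e)
open B7Prop2Explicit (avgIter avgIter_zero avgIter_succ rescale_apply mem_unitaryUnits)
open T4AveragingDeficitWall (IsUnitaryCfg SmallField)
open T4AveragingDeficitWallBoundary (IsPeriodicCfg)
open Summit.QuantumFields.BalabanUV.T4Continuum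
open MinimalActionRate (sfClass)
open NE3EnergyShapes (IsUnitarySite IsPeriodicSite)
open Literature.MathematicalPhysics.QuantumFieldTheory.Balaban1983to89.T4Continuum (T4Family holAt walk netDisp holAt_cons holAt_nil netDisp_cons netDisp_loopWord)
open Node00 (MatA SU ιSU cfgOfRecord avOfRecord liftCfgOfRecord₁₁ ne3NperOfRecord₁₁)
open Summit.QuantumFields.YangMills.BalabanUVNodes.N16AveragingPin (avgIterS step42 avgIterS_step42 avgIterS_succ descendSU step04 Transfer42to04 Transfer04to42)
open Summit.QuantumFields.YangMills.BalabanUVNodes.N16AveragingTransferOfGaugeDefect (ExactGaugeDefect)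
open Summit.QuantumFields.YangMills.BalabanUVNodes.N16CentreConventionTransfer (SchemeGaugeEquiv)
open Summit.QuantumFields.BalabanUV.T4Continuum.NE2.TorusBlockAverageConstant (bavg_const hol_const znet)

noncomputable section

/-! ## §1 Constant configurations on the B7 fold: (43) keeps them constant; they lie in every small-field class -/

section Fold

variable {d : ℕ} {n : Type*} [Fintype n] [DecidableEq n]

/-- **(43) OF A CONSTANT CONNECTION**: `avgIter L (· ≡ c) k ≡ c ^ L ^ k` — each step (42) raises the constant to the `L`-th power (NE2 `bavg_const`), rescaling keeps
constants; (43) PRESERVES the Polyakov phase of a constant connection exactly. [cite: Balaban1985Averaging, (42)–(43) pp.23–24 (shape)] -/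
theorem avgIter_const [Nonempty n] (L : ℕ) (c : (Matrix n n ℂ)ˣ) :
    ∀ k : ℕ, avgIter L (fun (_ : B7Prop1Explicit.Site d) (_ : Fin d) => c) k = fun _ _ => c ^ L ^ k
  | 0 => by funext x μ; rw [avgIter_zero, pow_zero, pow_one]
  | k + 1 => by
    rw [avgIter_succ, avgIter_const L c k, bavg_const]
    funext x μ
    rw [rescale_apply, ← pow_mul, ← pow_succ]

/-- The same for g0's scheme iterate at `step42`: `avgIterS (step42 L) k (· ≡ c) ≡ c ^ L ^ k`. [folklore] -/
theorem avgIterS_step42_const [Nonempty n] (L k : ℕ) (c : (Matrix n n ℂ)ˣ) :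
    avgIterS (fun _ => step42 (n := n) L) k (fun (_ : B7Prop1Explicit.Site d) (_ : Fin d) => c) = fun _ _ => c ^ L ^ k := by
  rw [avgIterS_step42, avgIter_const]

/-- A constant unitary configuration is `U(N)`-valued. [folklore] -/
theorem isUnitaryCfg_const {c : (Matrix n n ℂ)ˣ} (hc : (c : Matrix n n ℂ) ∈ unitary (Matrix n n ℂ)) :
    IsUnitaryCfg (fun (_ : B7Prop1Explicit.Site d) (_ : Fin d) => c) := fun _ _ => mem_unitaryUnits.2 hc

/-- A constant configuration is periodic of every period. [folklore] -/
theorem isPeriodicCfg_const (c : (Matrix n n ℂ)ˣ) (P : ℤ) : IsPeriodicCfg (fun (_ : B7Prop1Explicit.Site d) (_ : Fin d) => c) P := fun _ _ _ => rfl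

/-- A constant configuration is FLAT: every plaquette holonomy is `c·c·c⁻¹·c⁻¹ = 1` (as many forward as backward letters). [folklore] -/
theorem hol_const_plaqWord (c : (Matrix n n ℂ)ˣ) (x : B7Prop1Explicit.Site d) (κ κ' : Fin d) :
    hol (fun (_ : B7Prop1Explicit.Site d) (_ : Fin d) => c) x (plaqWord κ κ') = 1 := by
  rw [hol_const, show znet (plaqWord κ κ') = 0 by simp [znet, plaqWord], zpow_zero]

/-- … hence it lies in the small-field domain of every non-negative radius. [folklore] -/
theorem smallField_const (c : (Matrix n n ℂ)ˣ) {a : ℝ} (ha : 0 ≤ a) : SmallField (fun (_ : B7Prop1Explicit.Site d) (_ : Fin d) => c) a := by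
  intro x κ κ' _
  rw [hol_const_plaqWord, Units.val_one, sub_self, norm_zero]
  exact ha

/-- **★ A CONSTANT UNITARY CONFIGURATION LIES IN EVERY SMALL-FIELD CLASS** `sfClass d L T ε k`, `ε ≥ 0` (flat, `U(N)`-valued, periodic of every period) — in particular in
every class the road of part 18 §4 quantifies over. [cite: Balaban1985Variational, (2) p.278, (6) p.278 (shape)] -/
theorem const_mem_sfClass {c : (Matrix n n ℂ)ˣ} (hc : (c : Matrix n n ℂ) ∈ unitary (Matrix n n ℂ)) (L T : ℕ) {ε : ℝ} (hε : 0 ≤ ε) (k : ℕ) :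
    (fun (_ : B7Prop1Explicit.Site d) (_ : Fin d) => c) ∈ sfClass d L T ε k :=
  ⟨isUnitaryCfg_const hc, isPeriodicCfg_const c _, smallField_const c (div_nonneg hε (by positivity))⟩

end Fold

/-! ## §2 The reading of record on constant configurations: junk for `c ∉ SU(N)` -/

section Reading

variable (F : T4Family) (N : ℕ) [NeZero N]

/-- **DIVERGENCE (d1) IN ACTION**: for a constant with value OUTSIDE `SU(N)` g0's descent `descendSU` reads the junk branch at every bond: the TRIVIAL torus field. [folklore] -/
theorem descendSU_const_of_not_mem (t : ℕ) {c : (MatA N)ˣ} (hc : (c : MatA N) ∉ Matrix.specialUnitaryGroup (Fin N) ℂ) :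
    descendSU F N t (fun (_ : Fin 4 → ℤ) (_ : Fin 4) => c) = (1 : cfgOfRecord F N t 0) := by
  funext b
  unfold descendSU
  rw [dif_neg hc]
  rfl

omit [NeZero N] in
/-- For a constant configuration with value INSIDE `SU(N)` the descent is literal: the constant torus field. [folklore] -/
theorem descendSU_const_of_mem (t : ℕ) {c : (MatA N)ˣ} (hc : (c : MatA N) ∈ Matrix.specialUnitaryGroup (Fin N) ℂ) :
    descendSU F N t (fun (_ : Fin 4 → ℤ) (_ : Fin 4) => c) = fun _ => ⟨(c : MatA N), hc⟩ := by
  funext b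
  unfold descendSU
  rw [dif_pos hc]

/-- The descent of the trivial configuration is the trivial torus field. [folklore] -/
theorem descendSU_one (t : ℕ) : descendSU F N t (1 : (Fin 4 → ℤ) → Fin 4 → (MatA N)ˣ) = (1 : cfgOfRecord F N t 0) := by
  have h1 : (((1 : (MatA N)ˣ) : MatA N)) ∈ Matrix.specialUnitaryGroup (Fin N) ℂ := by
    rw [Units.val_one]; exact (1 : SU N).2
  have h := descendSU_const_of_mem F N t (c := 1) h1
  show descendSU F N t (fun (_ : Fin 4 → ℤ) (_ : Fin 4) => (1 : (MatA N)ˣ)) = 1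
  rw [h]
  funext b
  exact Subtype.ext Units.val_one

/-- The record's lift of the trivial torus field is the trivial configuration. [folklore] -/
theorem liftCfgOfRecord₁₁_one (t k : ℕ) : liftCfgOfRecord₁₁ F N t k (1 : cfgOfRecord F N t k) = 1 := by
  funext x κ
  rw [Node00.liftCfgOfRecord₁₁_apply]
  exact map_one (ιSU N)

/-- The (0.4) step of record fixes the trivial configuration (`Node00.avOfRecord_avg_one`: `M(1) = 1` for the printed `exp[mean log]`). [cite: Balaban1987RG1, (0.4) p.253] -/
theorem step04_one (t : ℕ) : step04 F N t (1 : (Fin 4 → ℤ) → Fin 4 → (MatA N)ˣ) = 1 := by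
  unfold step04
  rw [descendSU_one, Node00.avOfRecord_avg_one, liftCfgOfRecord₁₁_one]

/-- … hence so does every `k`-fold (0.4)-average of record. [folklore] -/
theorem avgIterS_step04_one : ∀ k : ℕ, avgIterS (step04 F N) k (1 : (Fin 4 → ℤ) → Fin 4 → (MatA N)ˣ) = 1
  | 0 => rfl
  | k + 1 => by rw [avgIterS_succ, step04_one, avgIterS_step04_one k]

/-- **THE (0.4) STEP OF RECORD KILLS A NON-`SU(N)` CONSTANT**: `step04 F N t (· ≡ c) ≡ 1` for `c ∉ SU(N)` (junk descent, then `M(1) = 1`, then the lift of `1`). [folklore] -/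
theorem step04_const_of_not_mem (t : ℕ) {c : (MatA N)ˣ} (hc : (c : MatA N) ∉ Matrix.specialUnitaryGroup (Fin N) ℂ) :
    step04 F N t (fun (_ : Fin 4 → ℤ) (_ : Fin 4) => c) = 1 := by
  unfold step04
  rw [descendSU_const_of_not_mem F N t hc, Node00.avOfRecord_avg_one, liftCfgOfRecord₁₁_one]

/-- **★ EVERY `(k+1)`-FOLD (0.4)-AVERAGE OF RECORD OF A NON-`SU(N)` CONSTANT IS TRIVIAL** — the Polyakov phase is LOST at the first step. [folklore] -/
theorem avgIterS_step04_succ_const_of_not_mem (k : ℕ) {c : (MatA N)ˣ} (hc : (c : MatA N) ∉ Matrix.specialUnitaryGroup (Fin N) ℂ) :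
    avgIterS (step04 F N) (k + 1) (fun (_ : Fin 4 → ℤ) (_ : Fin 4) => c) = 1 := by
  rw [avgIterS_succ, step04_const_of_not_mem F N (k + 1) hc, avgIterS_step04_one]

end Reading

/-! ## §3 The obstruction: a periodic gauge cannot turn a constant with a non-trivial Polyakov phase into the trivial configuration -/

section Obstruction

variable {d : ℕ} {G : Type*} [Group G]

/-- If `(· ≡ 1) = (· ≡ c')^{κ}` then `κ` advances by `c'` along every bond: `κ (x + e μ) = κ x * c'`. [cite: Balaban1985Averaging, (8) p.18 (shape)] -/
theorem apply_add_e_of_one_eq_gaugeAct_const {κ : B7Prop1Explicit.Site d → G} {c' : G}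
    (h : (fun (_ : B7Prop1Explicit.Site d) (_ : Fin d) => (1 : G)) = gaugeAct κ (fun (_ : B7Prop1Explicit.Site d) (_ : Fin d) => c')) (x : B7Prop1Explicit.Site d) (μ : Fin d) :
    κ (x + e μ) = κ x * c' := by
  have hx := congrFun (congrFun h x) μ
  simp only [gaugeAct] at hx
  have := congrArg (· * κ (x + e μ)) hx
  simp only [one_mul, inv_mul_cancel_right] at this
  exact this

/-- … hence by `c'^m` along `m` steps: `κ (x + m • e μ) = κ x * c' ^ m`. [folklore] -/
theorem apply_add_nsmul_of_one_eq_gaugeAct_const {κ : B7Prop1Explicit.Site d → G} {c' : G}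
    (h : (fun (_ : B7Prop1Explicit.Site d) (_ : Fin d) => (1 : G)) = gaugeAct κ (fun (_ : B7Prop1Explicit.Site d) (_ : Fin d) => c')) (x : B7Prop1Explicit.Site d) (μ : Fin d) :
    ∀ m : ℕ, κ (x + (m : ℤ) • e μ) = κ x * c' ^ m
  | 0 => by simp
  | m + 1 => by
    rw [Nat.cast_succ, add_smul, one_smul, ← add_assoc, apply_add_e_of_one_eq_gaugeAct_const h, apply_add_nsmul_of_one_eq_gaugeAct_const h x μ m,
      pow_succ, mul_assoc]

/-- **★ THE POLYAKOV OBSTRUCTION**: a `T`-PERIODIC site gauge `κ` with `(· ≡ 1) = (· ≡ c')^{κ}` forces `c' ^ T = 1` (`d ≥ 1`). [folklore] -/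
theorem pow_eq_one_of_one_eq_gaugeAct_const [NeZero d] {κ : B7Prop1Explicit.Site d → G} {c' : G} {T : ℕ} (hκP : ∀ (x : B7Prop1Explicit.Site d) (i : Fin d), κ (x + (T : ℤ) • e i) = κ x)
    (h : (fun (_ : B7Prop1Explicit.Site d) (_ : Fin d) => (1 : G)) = gaugeAct κ (fun (_ : B7Prop1Explicit.Site d) (_ : Fin d) => c')) : c' ^ T = 1 := by
  have h1 := apply_add_nsmul_of_one_eq_gaugeAct_const h 0 (0 : Fin d) T
  rw [hκP 0 (0 : Fin d)] at h1
  exact (mul_eq_left.1 h1.symm)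

variable (F : T4Family) (N : ℕ) [NeZero N]

/-- **★★ THE CENTRE WITNESS AGAINST `SchemeGaugeEquiv`**: if a class `C` contains a constant configuration `· ≡ c` with `c ∉ SU(N)` and `c ^ (F.L ^ (k+1) · T) ≠ 1`, then
the (0.4)-scheme of record is NOT coarse-gauge equivalent to (42)∕(43) at depth `k+1` on `C` with `T`-periodic gauges: the left side of the (defect) clause is `· ≡ 1`
(§2), the right side a `T`-periodic gauge transform of `· ≡ c^{L^{k+1}}` (§1), and §3's obstruction bites. [folklore] -/
theorem not_schemeGaugeEquiv_step04_of_const_mem {k T : ℕ} {C : Set ((Fin 4 → ℤ) → Fin 4 → (MatA N)ˣ)} {c : (MatA N)ˣ}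
    (hcC : (fun (_ : Fin 4 → ℤ) (_ : Fin 4) => c) ∈ C) (hc : (c : MatA N) ∉ Matrix.specialUnitaryGroup (Fin N) ℂ)
    (hcT : c ^ (F.L ^ (k + 1) * T) ≠ 1) :
    ¬ SchemeGaugeEquiv 4 (fun _ => step42 F.L) (step04 F N) F.L T (k + 1) C := by
  intro hE
  obtain ⟨κ, -, hκP, hdef⟩ := hE.defect _ hcC
  rw [avgIterS_step04_succ_const_of_not_mem F N k hc, avgIterS_step42_const] at hdef
  have h1 : (c ^ F.L ^ (k + 1)) ^ T = 1 := pow_eq_one_of_one_eq_gaugeAct_const (d := 4) hκP hdef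
  exact hcT (by rwa [← pow_mul] at h1)

/-- **★★ THE CENTRE WITNESS AGAINST PART 12's CRITERION** `ExactGaugeDefect 4 (step04 F N) F.L T (k+1) C` (the same clause read against (43)). [folklore] -/
theorem not_exactGaugeDefect_step04_of_const_mem {k T : ℕ} {C : Set ((Fin 4 → ℤ) → Fin 4 → (MatA N)ˣ)} {c : (MatA N)ˣ}
    (hcC : (fun (_ : Fin 4 → ℤ) (_ : Fin 4) => c) ∈ C) (hc : (c : MatA N) ∉ Matrix.specialUnitaryGroup (Fin N) ℂ)
    (hcT : c ^ (F.L ^ (k + 1) * T) ≠ 1) :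
    ¬ ExactGaugeDefect 4 (step04 F N) F.L T (k + 1) C := by
  intro hE
  obtain ⟨κ, -, hκP, hdef⟩ := hE.defect _ hcC
  rw [avgIterS_step04_succ_const_of_not_mem F N k hc, avgIter_const] at hdef
  have h1 : (c ^ F.L ^ (k + 1)) ^ T = 1 := pow_eq_one_of_one_eq_gaugeAct_const (d := 4) hκP hdef
  exact hcT (by rwa [← pow_mul] at h1)

/-- **THE `U(1)` CENTRE SUPPLIES THE WITNESS** for every `N ≥ 1` and every exponent `m ≥ 1`: `c = ω·1` with `ω = e^{2πi∕M}`, `M = N·m + 1` is unitary, has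
`det c = ω^N ≠ 1` (so `c ∉ SU(N)`) and `c^m = ω^m·1 ≠ 1`, since `0 < N, m < M` and `ω` is a PRIMITIVE `M`-th root of unity (`Complex.isPrimitiveRoot_exp`). [folklore] -/
theorem exists_centre_unit {m : ℕ} (hm : 1 ≤ m) :
    ∃ c : (MatA N)ˣ, (c : MatA N) ∈ unitary (MatA N) ∧ (c : MatA N) ∉ Matrix.specialUnitaryGroup (Fin N) ℂ ∧ c ^ m ≠ 1 := by
  have hN : 1 ≤ N := Nat.one_le_iff_ne_zero.2 (NeZero.ne N)
  set M : ℕ := N * m + 1 with hM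
  have hM0 : M ≠ 0 := by omega
  have hprim : IsPrimitiveRoot (Complex.exp (2 * Real.pi * Complex.I / M)) M := Complex.isPrimitiveRoot_exp M hM0
  set ω : ℂ := Complex.exp (2 * Real.pi * Complex.I / M) with hω
  have hω0 : ω ≠ 0 := Complex.exp_ne_zero _
  have hωnorm : ‖ω‖ = 1 := hprim.norm'_eq_one hM0
  -- `ω^N ≠ 1` and `ω^m ≠ 1`: `M` divides neither `N` nor `m`
  have hωN : ω ^ N ≠ 1 := by
    intro h
    have hd : M ∣ N := (hprim.pow_eq_one_iff_dvd N).1 h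
    have : M ≤ N := Nat.le_of_dvd (by omega) hd
    have : N ≤ N * m := Nat.le_mul_of_pos_right N (by omega)
    omega
  have hωm : ω ^ m ≠ 1 := by
    intro h
    have hd : M ∣ m := (hprim.pow_eq_one_iff_dvd m).1 h
    have : M ≤ m := Nat.le_of_dvd (by omega) hd
    have : m ≤ N * m := Nat.le_mul_of_pos_left m (by omega)
    omega
  -- the unit `ω·1`
  let c : (MatA N)ˣ := Units.map (algebraMap ℂ (MatA N) : ℂ →* MatA N) (Units.mk0 ω hω0)
  have hcval : (c : MatA N) = ω • (1 : MatA N) := by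
    show algebraMap ℂ (MatA N) ω = _
    exact Algebra.algebraMap_eq_smul_one ω
  refine ⟨c, ?_, ?_, ?_⟩
  · -- unitary: `(ω̄·1)(ω·1) = |ω|²·1 = 1`
    have hnsq : Complex.normSq ω = 1 := by rw [Complex.normSq_eq_norm_sq, hωnorm, one_pow]
    have hωω' : ω * (starRingEnd ℂ) ω = 1 := by rw [Complex.mul_conj, hnsq, Complex.ofReal_one]
    have hωω : (starRingEnd ℂ) ω * ω = 1 := by rw [mul_comm]; exact hωω'
    rw [hcval, Unitary.mem_iff, star_smul, star_one, Complex.star_def, smul_mul_smul_comm, mul_one, hωω, one_smul, smul_mul_smul_comm, mul_one, hωω', one_smul]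
    exact ⟨rfl, rfl⟩
  · -- not special: `det (ω·1) = ω^N ≠ 1`
    intro hsu
    have hdet := (Matrix.mem_specialUnitaryGroup_iff.1 hsu).2
    rw [hcval, Matrix.det_smul, Matrix.det_one, mul_one, Fintype.card_fin] at hdet
    exact hωN hdet
  · -- `c^m = ω^m·1 ≠ 1`: read the `(0,0)` entry
    intro h
    have h0 : ((c ^ m : (MatA N)ˣ) : MatA N) = ω ^ m • (1 : MatA N) := by
      rw [Units.val_pow_eq_pow_val, hcval, smul_pow, one_pow]
    have h00 := congrArg (fun A : MatA N => A ⟨0, hN⟩ ⟨0, hN⟩) h0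
    simp only [h, Units.val_one, Matrix.one_apply_eq, Matrix.smul_apply, smul_eq_mul, mul_one] at h00
    exact hωm h00.symm

/-- **★★ THE ROAD OF PART 18 §4 IS CLOSED OVER EVERY `U(N)` SMALL-FIELD CLASS**: for every `F`, `N ≥ 1`, `T ≥ 1`, depth `k+1` and radius `ε ≥ 0`,
`¬ SchemeGaugeEquiv 4 (step42 F.L) (step04 F N) F.L T (k+1) (sfClass 4 F.L T ε (k+1))` — the constant `U(1)`-centre configuration of `exists_centre_unit` is a member
(§1) on which the (defect) clause fails (§3). [folklore] -/
theorem not_schemeGaugeEquiv_step04_sfClass {T : ℕ} (hT : 1 ≤ T) (k : ℕ) {ε : ℝ} (hε : 0 ≤ ε) :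
    ¬ SchemeGaugeEquiv 4 (fun _ => step42 F.L) (step04 F N) F.L T (k + 1) (sfClass 4 F.L T ε (k + 1)) := by
  have hL : 1 ≤ F.L := F.hL.2.le
  have hm : 1 ≤ F.L ^ (k + 1) * T := Nat.one_le_iff_ne_zero.2 (Nat.mul_ne_zero (pow_ne_zero _ (by omega)) (by omega))
  obtain ⟨c, hcu, hcsu, hcm⟩ := exists_centre_unit N hm
  exact not_schemeGaugeEquiv_step04_of_const_mem F N (const_mem_sfClass hcu F.L T hε (k + 1)) hcsu hcm

/-- **★★ … AND SO IS PART 12's CRITERION ROAD**: `¬ ExactGaugeDefect 4 (step04 F N) F.L T (k+1) (sfClass 4 F.L T ε (k+1))` for every `T ≥ 1`, `k`, `ε ≥ 0`. [folklore] -/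
theorem not_exactGaugeDefect_step04_sfClass {T : ℕ} (hT : 1 ≤ T) (k : ℕ) {ε : ℝ} (hε : 0 ≤ ε) :
    ¬ ExactGaugeDefect 4 (step04 F N) F.L T (k + 1) (sfClass 4 F.L T ε (k + 1)) := by
  have hL : 1 ≤ F.L := F.hL.2.le
  have hm : 1 ≤ F.L ^ (k + 1) * T := Nat.one_le_iff_ne_zero.2 (Nat.mul_ne_zero (pow_ne_zero _ (by omega)) (by omega))
  obtain ⟨c, hcu, hcsu, hcm⟩ := exists_centre_unit N hm
  exact not_exactGaugeDefect_step04_of_const_mem F N (const_mem_sfClass hcu F.L T hε (k + 1)) hcsu hcm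

/-- N16's period of record is positive: `ne3NperOfRecord₁₁ F 0 0 = 2·L^m ≥ 1`. [folklore] -/
theorem one_le_ne3NperOfRecord₁₁ : 1 ≤ ne3NperOfRecord₁₁ F 0 0 := by
  have : 1 ≤ F.L ^ (F.m + 0 - 0) := Nat.one_le_pow _ _ (by have := F.hL.2; omega)
  rw [Node00.ne3NperOfRecord₁₁_eq]; omega

/-- **★★ THE HYPOTHESIS OF PART 18's `transfers_of_schemeGaugeEquiv_step04` IS UNSATISFIABLE**: for NO `ε₁ > 0` is the (0.4)-scheme of record coarse-gauge
equivalent to (42)∕(43) on all of N16's classes `sfClass 4 F.L (2L^m) ε (k+1)`, `0 < ε ≤ ε₁` — already `ε = ε₁`, `k = 0` fails by the centre witness.  The road AS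
TYPED (over the `U(N)` class) therefore yields nothing; see the header for the located repair. [folklore] -/
theorem not_hypothesis_transfers_of_schemeGaugeEquiv_step04 {ε₁ : ℝ} (hε₁ : 0 < ε₁) :
    ¬ (∀ ε : ℝ, 0 < ε → ε ≤ ε₁ → ∀ k : ℕ, SchemeGaugeEquiv 4 (fun _ => step42 F.L) (step04 F N) F.L (ne3NperOfRecord₁₁ F 0 0) (k + 1)
      (sfClass 4 F.L (ne3NperOfRecord₁₁ F 0 0) ε (k + 1))) :=
  fun hE => not_schemeGaugeEquiv_step04_sfClass F N (one_le_ne3NperOfRecord₁₁ F) 0 hε₁.le (hE ε₁ hε₁ le_rfl 0)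

end Obstruction

/-! ## §4 Positive complement: on constant `SU(N)`-valued configurations the reading is literal and (0.4) agrees with (42)∕(43) exactly -/

section Literal

variable {P : Params} {j : ℕ} {G : Type*} [GaugeGroup G]

/-- **PARALLEL TRANSPORT OF A CONSTANT TORUS FIELD** `U ≡ D` along any lattice walk is `D ^ (Σ_ν net displacement)` — each forward letter contributes `D`, each
backward one `D⁻¹`, and all factors commute. [cite: Balaban1985Averaging, (9) p.18 (shape)] -/
theorem holAt_walk_const (D : G) : ∀ (x : Site P j) (w : List (T4Continuum.Letter P.d)),
    holAt (fun _ : PBond P j => D) (walk x w) = D ^ (∑ ν, netDisp w ν)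
  | _, [] => by simp [walk, holAt_nil, netDisp]
  | x, (μ, true) :: w => by
      show holAt (fun _ : PBond P j => D) (⟨⟨x, μ⟩, true⟩ :: walk (x.shift μ) w) = _
      rw [holAt_cons, holAt_walk_const D (x.shift μ) w]
      simp only [netDisp_cons, Finset.sum_add_distrib, ↓reduceIte, Finset.sum_ite_eq, Finset.mem_univ, zpow_add, zpow_one]
  | x, (μ, false) :: w => by
      show holAt (fun _ : PBond P j => D) (⟨⟨x.unshift μ, μ⟩, false⟩ :: walk (x.unshift μ) w) = _
      rw [holAt_cons, holAt_walk_const D (x.unshift μ) w]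
      simp only [netDisp_cons, Finset.sum_add_distrib, ↓reduceIte, Finset.sum_ite_eq, Finset.mem_univ, zpow_add, zpow_neg, zpow_one,
        Bool.false_eq_true]

/-- **EVERY (0.4) LOOP VARIABLE OF A CONSTANT FIELD IS `1`** (the loop words are closed, `netDisp_loopWord`). [cite: Balaban1987RG1, (0.4) p.253] -/
theorem loopHol_const (D : G) (c : PBond P (j + 1)) (i : BlockAveraging.Idx P) : BlockAveraging.loopHol (fun _ : PBond P j => D) c i = 1 := by
  unfold BlockAveraging.loopHol
  rw [holAt_walk_const]
  simp only [netDisp_loopWord, Finset.sum_const_zero, zpow_zero]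

/-- The constant field is in the small-field domain of (0.4) at every coarse bond. [cite: Balaban1987RG1, (0.4) p.253 (bookkeeping)] -/
theorem small_const (ℰ : LoopAverage G) (D : G) (c : PBond P (j + 1)) : BlockAveraging.Small ℰ (fun _ : PBond P j => D) c := fun i => by
  rw [loopHol_const, GaugeGroup.dist1_one]
  exact ℰ.δ_pos

/-- The partial straight-line transporters of a constant field are `D ^ t`. [cite: Balaban1984PropagatorsI, (1.7) p.18 (bookkeeping)] -/
theorem pathProd_const (D : G) (c : PBond P (j + 1)) : ∀ t : ℕ, AveragingRT.pathProd (fun _ : PBond P j => D) c t = D ^ t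
  | 0 => by simp [AveragingRT.pathProd]
  | t + 1 => by rw [AveragingRT.pathProd, pathProd_const D c t, pow_succ]

/-- The axial transporter of a constant field is `D ^ L`. [cite: Balaban1984PropagatorsI, (1.7) p.18 (bookkeeping)] -/
theorem axialAvg_const (D : G) (c : PBond P (j + 1)) : AveragingRT.axialAvg (fun _ : PBond P j => D) c = D ^ P.L :=
  pathProd_const D c P.L

/-- **BAŁABAN's (0.4) AVERAGE OF A CONSTANT FIELD IS THE CONSTANT FIELD `D ^ L`**, for every small-loop average `ℰ` with `E(1) = 1` (the printed `exp[mean log]`: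
`T3DescentFibreTower.expMeanLogSU_E_one`). [cite: Balaban1987RG1, (0.4) p.253] -/
theorem avgFun_const (ℰ : LoopAverage G) (hE : ∀ n : ℕ, ℰ.E (fun _ : Fin (n + 1) => (1 : G)) = 1) (D : G) :
    BlockAveraging.avgFun ℰ (fun _ : PBond P j => D) = fun _ : PBond P (j + 1) => D ^ P.L := by
  funext c
  show BlockAveraging.corr ℰ (fun _ : PBond P j => D) c * AveragingRT.axialAvg (fun _ : PBond P j => D) c = _
  have hl : BlockAveraging.loopHol (fun _ : PBond P j => D) c = fun _ => 1 := funext (loopHol_const D c)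
  rw [BlockAveraging.corr, if_pos (small_const ℰ D c), hl, axialAvg_const]
  have h1 : ℰ.avg (fun _ : BlockAveraging.Idx P => (1 : G)) = 1 := hE _
  rw [h1, one_mul]

variable (F : T4Family) (N : ℕ) [NeZero N]

/-- The averaging OF RECORD of a constant `SU(N)` torus field `≡ D` is the constant field `≡ D ^ L` one level up. [cite: Balaban1987RG1, (0.4) p.253] -/
theorem avOfRecord_avg_const (t i : ℕ) (D : SU N) :
    (avOfRecord F N t i).avg (fun _ : PBond (F.P t) i => D) = fun _ : PBond (F.P t) (i + 1) => D ^ F.L := by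
  rw [Node00.avOfRecord_avg, avgFun_const _ T3DescentFibreTower.expMeanLogSU_E_one, T4Family.P_L]

/-- **★ THE (0.4) STEP OF RECORD ON A CONSTANT `SU(N)` CONFIGURATION IS LITERAL**: `step04 F N t (· ≡ c) ≡ c ^ L` for `c ∈ SU(N)` — literal descent, constant
average, lift. [folklore] -/
theorem step04_const_of_mem (t : ℕ) {c : (MatA N)ˣ} (hc : (c : MatA N) ∈ Matrix.specialUnitaryGroup (Fin N) ℂ) :
    step04 F N t (fun (_ : Fin 4 → ℤ) (_ : Fin 4) => c) = fun _ _ => c ^ F.L := by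
  unfold step04
  rw [descendSU_const_of_mem F N t hc, avOfRecord_avg_const]
  funext x κ
  rw [Node00.liftCfgOfRecord₁₁_apply, map_pow]
  congr 1
  exact Units.ext (Node00.coe_ιSU N ⟨(c : MatA N), hc⟩)

/-- **★★ CONSTANT `SU(N)` CONNECTIONS DO NOT SEPARATE THE SCHEMES**: for `c ∈ SU(N)`, `avgIterS (step04 F N) k (· ≡ c) = avgIter F.L (· ≡ c) k (≡ c ^ L ^ k)` at
every depth — once the reading is literal, (0.4) of record and (42)∕(43) agree EXACTLY on constants; the witness set of §3 is exactly the `U(N) ∖ SU(N)` centre. [folklore] -/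
theorem avgIterS_step04_const_eq_avgIter {c : (MatA N)ˣ} (hc : (c : MatA N) ∈ Matrix.specialUnitaryGroup (Fin N) ℂ) :
    ∀ k : ℕ, avgIterS (step04 F N) k (fun (_ : Fin 4 → ℤ) (_ : Fin 4) => c) = avgIter F.L (fun (_ : Fin 4 → ℤ) (_ : Fin 4) => c) k
  | 0 => rfl
  | k + 1 => by
    have hcL : ((c ^ F.L : (MatA N)ˣ) : MatA N) ∈ Matrix.specialUnitaryGroup (Fin N) ℂ := by
      rw [Units.val_pow_eq_pow_val]; exact pow_mem hc _
    rw [avgIterS_succ, step04_const_of_mem F N (k + 1) hc, avgIterS_step04_const_eq_avgIter hcL k, avgIter_const, avgIter_const]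
    funext x μ
    rw [← pow_mul, ← pow_succ']

end Literal

end
end Summit.QuantumFields.YangMills.BalabanUVNodes.N16Step04CentreWitness
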